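import Literature.NumberTheory.GaloisRepresentations.TwistedSumAlgebraic
import Literature.NumberTheory.GaloisRepresentations.FramedRepTwist
import HarnessLib

/-!
# Twisted sums with a twist of finite order: generic exponents, the mass separation of root
# multisets, and framed twists

Topic `Literature/NumberTheory/GaloisRepresentations` (theorems only).  Three elementary inputs of
the one-generator unscrewing of cyclic twists of prime order `p` (Taylor 1994 §3 for `n = 2`;
companion of `TwistedSumFiniteOrder`):

* `TwistedSum.card_bad_le` / `TwistedSum.generic_of_not_mem_bad` — for a character `ν` of prime
  exponent `p` which is non-trivial, and a decomposition `T₁, …, Tₙ` of a semisimple `A` into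
  irreducibles of dimension `< p`, the set `Bad = {b < p | ∃ i i', T_{i'} ≃ Tᵢ ⊗ ν^b}` has at most
  `n²` elements (freeness: `Tᵢ ≃ Tᵢ ⊗ ν^b` with `0 < b < p` forces `ν = 1` by determinants,
  `Representation.pow_finrank_eq_one_of_equiv_twist`), and every `b ∉ Bad` is GENERIC for `A`
  (`[A : W] > 0 ⇒ [A : W ⊗ ν^b] = 0`);
* `TwistedSum.exists_generic_exponent` — counting: if `#Bad + 6 ≤ p` then some `0 < k < p` avoids
  `Bad` and has `k, p - k, 2k mod p, -2k mod p` all different from a prescribed residue `j₀`;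
* `TwistedSum.multiset_eq_of_twist_pair` — the mass separation: if `X + Y = S + S'` and
  `X + ζ•Y = S + ζ•S'` with `ζ` of prime order `p`, `0 ∉ Y ∪ S'` and `#Y + #S' < p`, then
  `Y = S'` and `X = S` (the signed count `Y - S'` is `ζ`-invariant, and a non-zero `ζ`-invariant
  function avoiding `0` has support of size `≥ p`);
* `FramedRep.toRepresentation_twist` — the representation underlying a framed twist `ρ ⊗ χ` is the
  twist of the underlying representation.

## References

* R. Taylor, *l-adic representations associated to modular forms over imaginary quadratic
  fields. II*, Invent. Math. 116 (1994), §3. [Taylor1994]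
* M. Harris, K.-W. Lan, R. Taylor, J. Thorne, Res. Math. Sci. 3:37 (2016), §7 (Cor. 7.3: generic
  twists separate root multisets). [HarrisLanTaylorThorneRMS2016]
-/

noncomputable section

namespace Literature.NumberTheory.GaloisRepresentations

namespace TwistedSum

open Literature.RepresentationTheory.Semisimple Literature.RepresentationTheory.FiniteGroups

universe u v w

variable {k : Type u} [Field k] {Γ : Type v} [Group Γ]

/-! ### Freeness of twisting by a non-trivial character of prime exponent -/

section Free

variable {V : Type w} [AddCommGroup V] [Module k V] [FiniteDimensional k V]

/-- **Freeness.**  If `ν^p = 1` pointwise for a prime `p`, `ρ ≠ 0` has dimension `< p` and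
`ρ ≃ ρ ⊗ ν^b` with `¬ p ∣ b`, then `ν = 1` (determinants give `ν(g)^{b · dim ρ} = 1`, and
`p ∤ b · dim ρ`). [folklore] -/
theorem eq_one_of_equiv_twist_pow [Nontrivial V] {ν : Γ →* kˣ} {p : ℕ} (hp : p.Prime)
    (hνp : ∀ g, ν g ^ p = 1) (hdim : Module.finrank k V < p) {ρ : Representation k Γ V} {b : ℕ}
    (hb : ¬ p ∣ b) (e : Representation.Equiv ρ (Representation.twist ρ (ν ^ b))) : ν = 1 := by
  have hd : 0 < Module.finrank k V := Module.finrank_pos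
  have hcop : Nat.Coprime p (b * Module.finrank k V) := by
    rw [Nat.Prime.coprime_iff_not_dvd hp]
    intro h
    rcases (Nat.Prime.dvd_mul hp).1 h with h | h
    · exact hb h
    · exact absurd (Nat.le_of_dvd hd h) (not_le.2 hdim)
  refine MonoidHom.ext fun g => Units.ext ?_
  have h1 := Representation.pow_finrank_eq_one_of_equiv_twist e g
  rw [MonoidHom.pow_apply, Units.val_pow_eq_pow_val, ← pow_mul] at h1
  have h2 : ((ν g : kˣ) : k) ^ p = 1 := by rw [← Units.val_pow_eq_pow_val, hνp g, Units.val_one]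
  have h3 : ((ν g : kˣ) : k) ^ Nat.gcd p (b * Module.finrank k V) = 1 := pow_gcd_eq_one.2 ⟨h2, h1⟩
  rw [Nat.Coprime.gcd_eq_one hcop, pow_one] at h3
  rw [MonoidHom.one_apply, Units.val_one]
  exact h3

end Free

/-! ### The bad exponents of a decomposition -/

section Bad

variable {V : Type w} [AddCommGroup V] [Module k V]

open Classical in
/-- **At most `n²` bad exponents.**  For a non-trivial character `ν` of prime exponent `p`, and
irreducible `T₁, …, Tₙ` (subrepresentations of a representation of dimension `< p`), the set of
`b < p` such that `T_{i'} ≃ Tᵢ ⊗ ν^b` for some `i, i'` has at most `n²` elements: for each pair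
`(i, i')` there is at most one such `b`, by freeness. [folklore] -/
theorem card_bad_le [FiniteDimensional k V] {ν : Γ →* kˣ} {p : ℕ} (hp : p.Prime)
    (hνp : ∀ g, ν g ^ p = 1) (hν : ν ≠ 1)
    {A : Representation k Γ V} (hdim : Module.finrank k V < p) {n : ℕ}
    (T : Fin n → Subrepresentation A) (hT : ∀ i, (T i).toRepresentation.IsIrreducible) :
    ((Finset.range p).filter fun b => ∃ i i' : Fin n, Nonempty (Representation.Equiv
      (T i').toRepresentation (Representation.twist (T i).toRepresentation (ν ^ b)))).card ≤
      n ^ 2 := by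
  haveI := hT
  set Bad := (Finset.range p).filter fun b => ∃ i i' : Fin n, Nonempty (Representation.Equiv
      (T i').toRepresentation (Representation.twist (T i).toRepresentation (ν ^ b))) with hBad
  -- each pair `(i, i')` accounts for at most one `b`
  have key : ∀ (i i' : Fin n) (b b' : ℕ), b < p → b' < p →
      Nonempty (Representation.Equiv (T i').toRepresentation
        (Representation.twist (T i).toRepresentation (ν ^ b))) →
      Nonempty (Representation.Equiv (T i').toRepresentation
        (Representation.twist (T i).toRepresentation (ν ^ b'))) → b = b' := by
    intro i i' b b' hb hb' ⟨e⟩ ⟨e'⟩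
    by_contra hne
    wlog hlt : b < b' generalizing b b' e e'
    · exact this b' b hb' hb e' e (Ne.symm hne) (lt_of_le_of_ne (not_lt.1 hlt) (Ne.symm hne))
    -- `Tᵢ ⊗ ν^b ≃ Tᵢ ⊗ ν^{b'}`, so `Tᵢ ≃ Tᵢ ⊗ ν^{b' - b}`
    have e1 := e.symm.trans e'
    have e2 := Representation.Equiv.twist e1 (ν ^ b)⁻¹
    rw [Representation.twist_twist_inv, Representation.twist_twist] at e2
    have hpow : ν ^ b' * (ν ^ b)⁻¹ = ν ^ (b' - b) := MonoidHom.ext fun g => by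
      simp only [MonoidHom.mul_apply, MonoidHom.inv_apply, MonoidHom.pow_apply]
      rw [pow_sub _ hlt.le]
    rw [hpow] at e2
    haveI : Nontrivial (T i).toSubmodule :=
      Representation.nontrivial_of_isIrreducible (T i).toRepresentation
    have hdimi : Module.finrank k (T i).toSubmodule < p :=
      lt_of_le_of_lt (Submodule.finrank_le _) hdim
    refine hν (eq_one_of_equiv_twist_pow hp hνp hdimi ?_ e2)
    intro hdvd
    have := Nat.le_of_dvd (Nat.sub_pos_of_lt hlt) hdvd
    omega
  -- inject `Bad` into `Fin n × Fin n` (for `n = 0` the set `Bad` is empty)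
  rcases Nat.eq_zero_or_pos n with hn | hn
  · subst hn
    have : Bad = ∅ := by
      rw [hBad, Finset.filter_eq_empty_iff]
      rintro b - ⟨i, -, -⟩
      exact Fin.elim0 i
    rw [this, Finset.card_empty]
    exact Nat.zero_le _
  haveI : Nonempty (Fin n × Fin n) := ⟨(⟨0, hn⟩, ⟨0, hn⟩)⟩
  have hchoose : ∀ b ∈ Bad, ∃ q : Fin n × Fin n, Nonempty (Representation.Equiv
      (T q.2).toRepresentation (Representation.twist (T q.1).toRepresentation (ν ^ b))) := by
    intro b hb
    rw [hBad, Finset.mem_filter] at hb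
    obtain ⟨i, i', h⟩ := hb.2
    exact ⟨(i, i'), h⟩
  choose! q hq using hchoose
  calc Bad.card ≤ (Finset.univ : Finset (Fin n × Fin n)).card := by
        refine Finset.card_le_card_of_injOn q (fun b _ => Finset.mem_univ _) ?_
        intro b hb b' hb' hqq
        have hbp : b < p := Finset.mem_range.1 (Finset.mem_filter.1 hb).1
        have hb'p : b' < p := Finset.mem_range.1 (Finset.mem_filter.1 hb').1
        have h1 := hq b hb
        have h2 := hq b' hb'
        rw [hqq] at h1
        exact key _ _ b b' hbp hb'p h1 h2
    _ = n ^ 2 := by rw [Finset.card_univ, Fintype.card_prod, Fintype.card_fin, sq]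

open Classical in
/-- **Exponents outside `Bad` are generic.**  With `T₁, …, Tₙ` the irreducible constituents of a
semisimple `A` (counting formula of `Representation.exists_decomposition`), if `b` is not bad then
no irreducible occurring in `A` has its `ν^b`-twist occurring in `A`. [folklore] -/
theorem generic_of_not_mem_bad {ν : Γ →* kˣ} {A : Representation k Γ V} {n : ℕ}
    (T : Fin n → Subrepresentation A)
    (hcount : ∀ {X : Type w} [AddCommGroup X] [Module k X] [FiniteDimensional k X]
      (U : Representation k Γ X) [U.IsIrreducible],
      Representation.mult U A = (Finset.univ.filter fun i =>
        Nonempty (Representation.Equiv U (T i).toRepresentation)).card)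
    {b : ℕ} (hb : ¬ ∃ i i' : Fin n, Nonempty (Representation.Equiv
      (T i').toRepresentation (Representation.twist (T i).toRepresentation (ν ^ b))))
    {X : Type w} [AddCommGroup X] [Module k X] [FiniteDimensional k X]
    (Wr : Representation k Γ X) [Wr.IsIrreducible] (hW : 0 < Representation.mult Wr A) :
    Representation.mult (Representation.twist Wr (ν ^ b)) A = 0 := by
  rw [hcount Wr, Finset.card_pos] at hW
  obtain ⟨i, hi⟩ := hW
  obtain ⟨e⟩ := (Finset.mem_filter.1 hi).2
  rw [hcount, Finset.card_eq_zero, Finset.filter_eq_empty_iff]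
  rintro i' - ⟨e'⟩
  exact hb ⟨i, i', ⟨e'.symm.trans (Representation.Equiv.twist e (ν ^ b))⟩⟩

end Bad

/-! ### Counting: a generic exponent with four prescribed companions -/

/-- **A generic exponent exists.**  If `p` is prime, `Bad ⊆ ℕ` is finite with `#Bad + 6 ≤ p` and
`j₀` is any natural number, then there is `0 < k < p` with `k ∉ Bad` and `k`, `p - k`,
`2k mod p`, `(p - (2k mod p)) mod p` all different from `j₀` (each of the four conditions excludes
at most one `k`, since `k ↦ 2k mod p` is injective on `[0, p)` for odd `p`). [folklore] -/
theorem exists_generic_exponent {p : ℕ} (hp : p.Prime) (Bad : Finset ℕ) (j₀ : ℕ)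
    (hcard : Bad.card + 6 ≤ p) :
    ∃ kk : ℕ, 0 < kk ∧ kk < p ∧ kk ∉ Bad ∧ kk ≠ j₀ ∧ p - kk ≠ j₀ ∧ 2 * kk % p ≠ j₀ ∧
      (p - 2 * kk % p) % p ≠ j₀ := by
  classical
  have hp2 : p ≠ 2 := by intro h; subst h; simp at hcard
  have hodd : Odd p := hp.odd_of_ne_two hp2
  -- `k ↦ 2k mod p` is injective on `[0, p)`
  have hcop : Nat.Coprime p 2 := (Nat.Prime.coprime_iff_not_dvd hp).2 fun h =>
    hp2 ((Nat.prime_dvd_prime_iff_eq hp Nat.prime_two).1 h)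
  have hinj : ∀ a b : ℕ, a < p → b < p → 2 * a % p = 2 * b % p → a = b := by
    intro a b ha hb h
    have h1 : Nat.ModEq p (2 * a) (2 * b) := h
    exact Nat.ModEq.eq_of_lt_of_lt (Nat.ModEq.cancel_left_of_coprime hcop h1) ha hb
  -- the violators
  let V₁ : Finset ℕ := (Finset.range p).filter fun kk => 2 * kk % p = j₀
  let V₂ : Finset ℕ := (Finset.range p).filter fun kk => (p - 2 * kk % p) % p = j₀
  have hV₁ : V₁.card ≤ 1 := Finset.card_le_one.2 fun a ha b hb => by
    rw [Finset.mem_filter, Finset.mem_range] at ha hb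
    exact hinj a b ha.1 hb.1 (ha.2.trans hb.2.symm)
  have hV₂ : V₂.card ≤ 1 := Finset.card_le_one.2 fun a ha b hb => by
    rw [Finset.mem_filter, Finset.mem_range] at ha hb
    refine hinj a b ha.1 hb.1 ?_
    have ha2 : 2 * a % p < p := Nat.mod_lt _ hp.pos
    have hb2 : 2 * b % p < p := Nat.mod_lt _ hp.pos
    have h := ha.2.trans hb.2.symm
    -- `(p - x) % p = (p - y) % p` with `x, y < p` forces `x = y`
    rcases Nat.eq_zero_or_pos (2 * a % p) with hx | hx <;>
      rcases Nat.eq_zero_or_pos (2 * b % p) with hy | hy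
    · rw [hx, hy]
    · rw [hx, Nat.sub_zero, Nat.mod_self, Nat.mod_eq_of_lt (Nat.sub_lt hp.pos hy)] at h; omega
    · rw [hy, Nat.sub_zero, Nat.mod_self, Nat.mod_eq_of_lt (Nat.sub_lt hp.pos hx)] at h; omega
    · rw [Nat.mod_eq_of_lt (Nat.sub_lt hp.pos hx), Nat.mod_eq_of_lt (Nat.sub_lt hp.pos hy)] at h
      omega
  let Bad' : Finset ℕ := Bad ∪ {j₀} ∪ {p - j₀} ∪ V₁ ∪ V₂ ∪ {0}
  have hBad' : Bad'.card ≤ Bad.card + 5 := by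
    calc Bad'.card ≤ (Bad ∪ {j₀} ∪ {p - j₀} ∪ V₁ ∪ V₂).card + ({0} : Finset ℕ).card :=
          Finset.card_union_le _ _
      _ ≤ (Bad ∪ {j₀} ∪ {p - j₀} ∪ V₁).card + V₂.card + 1 := by
          gcongr
          · exact Finset.card_union_le _ _
          · simp
      _ ≤ (Bad ∪ {j₀} ∪ {p - j₀}).card + V₁.card + 1 + 1 := by
          gcongr
          exact Finset.card_union_le _ _
      _ ≤ (Bad ∪ {j₀}).card + ({p - j₀} : Finset ℕ).card + 1 + 1 + 1 := by
          gcongr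
          exact Finset.card_union_le _ _
      _ ≤ Bad.card + 1 + 1 + 1 + 1 + 1 := by
          gcongr
          · exact (Finset.card_union_le _ _).trans (by simp)
          · simp
      _ = Bad.card + 5 := by ring
  -- some `k < p` is not a violator
  have hlt : Bad'.card < (Finset.range p).card := by
    rw [Finset.card_range]; omega
  obtain ⟨kk, hkp, hkB⟩ := Finset.exists_mem_notMem_of_card_lt_card hlt
  rw [Finset.mem_range] at hkp
  simp only [Bad', Finset.mem_union, Finset.mem_singleton, not_or] at hkB
  obtain ⟨⟨⟨⟨⟨hB, hj₀⟩, hpj₀⟩, hV₁k⟩, hV₂k⟩, hk0⟩ := hkB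
  refine ⟨kk, Nat.pos_of_ne_zero hk0, hkp, hB, hj₀, ?_, ?_, ?_⟩
  · omega
  · intro h; exact hV₁k (Finset.mem_filter.2 ⟨Finset.mem_range.2 hkp, h⟩)
  · intro h; exact hV₂k (Finset.mem_filter.2 ⟨Finset.mem_range.2 hkp, h⟩)

/-! ### Mass separation of root multisets under a twist of prime order -/

/-- **Mass separation.**  Let `ζ ∈ k` have `ζ^p = 1 ≠ ζ` for a prime `p`, and let `X, Y, S, S'`
be multisets with `0 ∉ Y`, `0 ∉ S'`, `#Y + #S' < p`, `X + Y = S + S'` and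
`X + ζ•Y = S + ζ•S'`.  Then `Y = S'` (and hence `X = S`): the signed count `D = Y - S'` satisfies
`D(ζz) = D(z)`, so a point `z₀ ≠ 0` with `D(z₀) ≠ 0` would give `p` distinct points `ζⁱz₀` in
`Y ∪ S'` (cf. Harris–Lan–Taylor–Thorne 2016, proof of Cor. 7.3, with "infinite order" replaced by
"order `p` exceeding the mass"). [folklore] -/
theorem multiset_eq_of_twist_pair {ζ : k} {p : ℕ} (hp : p.Prime) (hζp : ζ ^ p = 1) (hζ1 : ζ ≠ 1)
    {X Y S S' : Multiset k} (h0Y : (0 : k) ∉ Y) (h0S' : (0 : k) ∉ S')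
    (hcard : Multiset.card Y + Multiset.card S' < p) (h1 : X + Y = S + S')
    (h2 : X + Y.map (ζ * ·) = S + S'.map (ζ * ·)) : Y = S' := by
  classical
  haveI : Fact p.Prime := ⟨hp⟩
  have hζ0 : ζ ≠ 0 := by
    rintro rfl
    rw [zero_pow hp.ne_zero] at hζp
    exact zero_ne_one hζp
  have hord : orderOf ζ = p := orderOf_eq_prime hζp hζ1
  -- the signed count `D = Y - S'` and its `ζ`-invariance
  set D : k → ℤ := fun z => (Multiset.count z Y : ℤ) - Multiset.count z S' with hD
  have hcnt : ∀ (M : Multiset k) (z : k), Multiset.count (ζ * z) (M.map (ζ * ·)) = Multiset.count z M :=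
    fun M z => Multiset.count_map_eq_count' _ _ (mul_right_injective₀ hζ0) _
  have hDζ : ∀ z, D (ζ * z) = D z := by
    intro z
    have e1 := congrArg (Multiset.count (ζ * z)) h1
    have e2 := congrArg (Multiset.count (ζ * z)) h2
    simp only [Multiset.count_add, hcnt] at e1 e2
    simp only [hD]
    omega
  have hDpow : ∀ (i : ℕ) (z : k), D (ζ ^ i * z) = D z := by
    intro i
    induction i with
    | zero => intro z; simp
    | succ i ih => intro z; rw [pow_succ', mul_assoc, hDζ, ih]
  -- if `D ≠ 0` somewhere, we get `p` distinct points in `Y ∪ S'`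
  by_contra hne
  have hz : ∃ z₀, D z₀ ≠ 0 := by
    by_contra hall
    push Not at hall
    exact hne (Multiset.ext.2 fun z => by have := hall z; simp only [hD] at this; omega)
  obtain ⟨z₀, hz₀⟩ := hz
  have hsupp : ∀ z, D z ≠ 0 → z ∈ (Y + S').toFinset := by
    intro z hz
    rw [Multiset.mem_toFinset, Multiset.mem_add]
    by_contra h
    push Not at h
    simp only [hD, Multiset.count_eq_zero.2 h.1, Multiset.count_eq_zero.2 h.2] at hz
    exact hz rfl
  have hz₀0 : z₀ ≠ 0 := by
    intro h
    have hmem := hsupp z₀ hz₀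
    rw [h, Multiset.mem_toFinset, Multiset.mem_add] at hmem
    exact hmem.elim h0Y h0S'
  -- the orbit `ζⁱ z₀`, `i < p`, injects into the support
  have horb : ((Finset.range p).image fun i => ζ ^ i * z₀) ⊆ (Y + S').toFinset := by
    intro z hz
    rw [Finset.mem_image] at hz
    obtain ⟨i, -, rfl⟩ := hz
    exact hsupp _ (by rw [hDpow]; exact hz₀)
  have hcard_orb : ((Finset.range p).image fun i => ζ ^ i * z₀).card = p := by
    rw [Finset.card_image_of_injOn, Finset.card_range]
    intro i hi j hj h
    have h' : ζ ^ i = ζ ^ j := mul_right_cancel₀ hz₀0 h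
    exact pow_injOn_Iio_orderOf (by simpa [hord] using hi) (by simpa [hord] using hj) h'
  have h3 := Finset.card_le_card horb
  rw [hcard_orb] at h3
  have h4 : (Y + S').toFinset.card ≤ Multiset.card Y + Multiset.card S' :=
    (Multiset.toFinset_card_le _).trans (by rw [Multiset.card_add])
  omega

/-- Mass separation, both halves: under the hypotheses of `multiset_eq_of_twist_pair` also
`X = S`. [folklore] -/
theorem multiset_eq_of_twist_pair' {ζ : k} {p : ℕ} (hp : p.Prime) (hζp : ζ ^ p = 1) (hζ1 : ζ ≠ 1)
    {X Y S S' : Multiset k} (h0Y : (0 : k) ∉ Y) (h0S' : (0 : k) ∉ S')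
    (hcard : Multiset.card Y + Multiset.card S' < p) (h1 : X + Y = S + S')
    (h2 : X + Y.map (ζ * ·) = S + S'.map (ζ * ·)) : X = S ∧ Y = S' := by
  have hY := multiset_eq_of_twist_pair hp hζp hζ1 h0Y h0S' hcard h1 h2
  subst hY
  exact ⟨add_right_cancel h1, rfl⟩

end TwistedSum

/-! ### Framed twists and the underlying representation -/

section FramedTwist

variable {G : Type*} [Group G] [TopologicalSpace G] {A : Type*} [CommRing A] [TopologicalSpace A]
  [IsTopologicalRing A] {n : ℕ}

/-- The representation underlying a framed twist `ρ ⊗ χ` is the twist of the underlying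
representation by the character `χ` (as a `MonoidHom`). [folklore] -/
theorem FramedRep.toRepresentation_twist {A : Type*} [Field A] [TopologicalSpace A]
    [IsTopologicalRing A] (ρ : FramedRep G A n) (χ : G →ₜ* Aˣ) :
    (ρ.twist χ).toRepresentation =
      Literature.RepresentationTheory.Semisimple.Representation.twist ρ.toRepresentation
        (χ : G →* Aˣ) := by
  refine MonoidHom.ext fun g => LinearMap.ext fun v => ?_
  rw [FramedRep.toRepresentation_apply_apply, FramedRep.coe_twist_apply,
    Literature.RepresentationTheory.Semisimple.Representation.twist_apply_apply,
    FramedRep.toRepresentation_apply_apply, Matrix.smul_mulVec]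
  rfl

end FramedTwist

end Literature.NumberTheory.GaloisRepresentations
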